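import Summits.CriticalPhenomena.PercolationContinuityZ3.Theorems.PercNearOneGluingNoHeavyQuantFarSunHairCount
import Summits.CriticalPhenomena.PercolationContinuityZ3.Theorems.PercNearOneGluingNoHeavyQuantSurplusFAR
import Summits.CriticalPhenomena.PercolationContinuityZ3.Theorems.PercNearOneGluingNoHeavyQuantDeficitFAR
import HarnessLib

/-!
# FAR beyond trees: THM B — the WEAKEST-HAIR BET `W(μ_W)` is a hair-only certificate for `SunFAR K 2` whenever `η(Σ − 4) ≤ 2(F − η)`
# (LEMMA L: its long rows never bind)

builds on p205010 (kernel theorem, internal audit signed; external expert review pending)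

Support file (`--supports stmt-CriticalPhenomena-4575`), seat `prim-cert-1` (gen 37); memos `prim-cert-1/FROM-prim-cert-1-g34-UNIVERSAL-WITNESS.md` §3
(THM B, LEMMA L, the reduction to (∗)) and `prim-cert-1/FROM-prim-cert-1-g37-SURPLUS-FAR.md` §1, §4.  Layer `j = 2` throughout.
Notation: hair weights `h k ∈ [0,1]`, `Σ = Σ_{k<K} h k`, `η = h m` a least weight (`η ≤ h k`, `k < K`), `F = hairV K h 2 (range K) = P(T ≥ 3)`,
for a set of positions `C`: `E(C) = Σ_{k∈C} h k`, `V(C) = hairV K h 2 C = P(N_C ≥ 3)`.  The weakest-hair bet is the certificate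
`λ = δ_m`, `μ_W = (F − η)/(Σ − 4)` (rows `η·𝟙[m ∈ C] + μ_W (E(C) − 4) ≤ V(C)` on the coverage sets `C = cov K l l'`; the full row is tight).

* `HairyCycle.one_sub_hairV_mul_le` — the surplus inequality on a position set: `(1 − V(C))·(E(C) − 3) ≤ 1 − η` for `E(C) ≥ 4`
  (`Quant.CountDP.surplus_far_two` through the bridge `HairyCycle.hairV_eq_one_sub_cdf`); `HairyCycle.eta_le_hairV_univ` — `η ≤ F` for `Σ ≥ 4`.
* `HairyCycle.deficit_le_hairV` — the deficit inequality on a position set: `η(E(C) − 2)/2 ≤ V(C)` for `E(C) ≤ 4`, `η > 0`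
  (`Quant.CountDP.deficit_far_two` through the bridge).
* **`HairyCycle.lemmaL`** — LEMMA L: for every `C ⊆ range K` with `E(C) > 4`:  `(F − η)(E(C) − 4) ≤ (V(C) − η)(Σ − 4)`
  (proof, g34 §3: with `u = E(C) − 4`, `g = E(gap)`, `δ = F − V(C) ≤ (1 − V(C))·min(1, g)` (`HairyCycle.hairV_univ_sub_hairV_le`) and
  `(1 − V(C))u ≤ V(C) − η` (surplus): `(F−η)u ≤ (V−η)u + (V−η)min(1,g) ≤ (V−η)(u+g)`).
* **`HairyCycle.hairCert_of_weakestBet`** — THM B: if `4 < Σ`, `η = h m` is a least weight and `η(Σ − 4) ≤ 2(F − η)`, then `(δ_m, μ_W)` is a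
  hair-only certificate in the hypothesis shape of `HairyCycle.sunFAR_of_hairCert`: long rows by LEMMA L, short rows through `m` by the deficit
  inequality and `μ_W ≥ η/2`, the rest trivially.
With `HairyCycle.sunFAR_of_hairCert_lowWitness` / `…lowWitAvg` (the universal-witness rule, valid when its witness weight `G ≥ 1`) this leaves, for
`SunFAR K 2` at every `K ≥ 11`, exactly the conjectured inequality `G ≥ 1` on `R = {η(Σ−4) > 2(F−η)}` (memo g35 §0, g37 §2).
No definitions, no sorries, standard axioms.  Elementary [this work].
-/

noncomputable section

namespace Summit.CriticalPhenomena.PercolationContinuityZ3.Theorems.HairyCycle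

open Finset
open scoped Classical

/-- `PB[p, m] b` = probability that exactly `b` of the first `m` independent trials succeed (the recursion of `…QuantCountDP.lean`). -/
local notation3 "PB[" p ", " m "]" =>
  (Nat.rec (motive := fun _ => ℕ → ℝ) (fun b => if b = 0 then (1 : ℝ) else 0)
    (fun n f b => (p : ℕ → ℝ) n * (if b = 0 then (0 : ℝ) else f (b - 1)) + (1 - (p : ℕ → ℝ) n) * f b) (m : ℕ))

variable {K : ℕ}

/-! ## The bridged trials of a position set -/

/-- For `C ⊆ range K` the filter of `range K` by membership in `C` is `C`. [folklore] -/
theorem filter_mem_eq_self {C : Finset ℕ} (hC : C ⊆ range K) : (range K).filter (fun k => k ∈ C) = C := by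
  ext k
  simp only [Finset.mem_filter, Finset.mem_range]
  exact ⟨fun h => h.2, fun h => ⟨Finset.mem_range.1 (hC h), h⟩⟩

/-- `0 ≤ hairV K h j C` for `h ∈ [0,1]` on `range K`. [this work] -/
theorem hairV_nonneg' {h : ℕ → ℝ} (hh : ∀ k, k < K → 0 ≤ h k ∧ h k ≤ 1) (j : ℕ) (C : Finset ℕ) : 0 ≤ hairV K h j C :=
  Finset.sum_nonneg fun Q _ => mul_nonneg (hairW_nonneg hh Q) (by split_ifs <;> norm_num)

/-- `hairV K h j C ≤ 1` for `h ∈ [0,1]` on `range K`. [this work] -/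
theorem hairV_le_one' {h : ℕ → ℝ} (hh : ∀ k, k < K → 0 ≤ h k ∧ h k ≤ 1) (j : ℕ) (C : Finset ℕ) : hairV K h j C ≤ 1 :=
  calc hairV K h j C ≤ ∑ Q ∈ (range K).powerset, hairW K h Q :=
        Finset.sum_le_sum fun Q _ => by
          have := hairW_nonneg hh Q
          split_ifs <;> nlinarith
    _ = 1 := sum_hairW_eq_one h

/-- The bridged trials `i ↦ h (nth_C i)` take values in `[0,1]` when `h` does (everywhere). [this work] -/
theorem nth_trials_mem {h : ℕ → ℝ} (hh : ∀ k, 0 ≤ h k ∧ h k ≤ 1) (C : Finset ℕ) :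
    ∀ i, 0 ≤ (fun i => h (Nat.nth (· ∈ C) i)) i ∧ (fun i => h (Nat.nth (· ∈ C) i)) i ≤ 1 :=
  fun _ => hh _

/-- The first `Nat.count (· ∈ C) K` bridged trials are hairs of index `< K`, hence at least the least weight `η`. [this work] -/
theorem eta_le_nth_trials {h : ℕ → ℝ} {η : ℝ} (hη : ∀ k, k < K → η ≤ h k) (C : Finset ℕ) :
    ∀ i, i < Nat.count (· ∈ C) K → η ≤ (fun i => h (Nat.nth (· ∈ C) i)) i :=
  fun _ hi => hη _ (Nat.nth_lt_of_lt_count hi)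

/-- The mean of the bridged trials of `C ⊆ range K` is `E(C) = Σ_{k∈C} h k`. [this work] -/
theorem sum_nth_trials_eq {C : Finset ℕ} (hC : C ⊆ range K) (h : ℕ → ℝ) :
    ∑ i ∈ range (Nat.count (· ∈ C) K), (fun i => h (Nat.nth (· ∈ C) i)) i = ∑ k ∈ C, h k := by
  have := sum_nth_eq_sum_filter h C K
  rw [filter_mem_eq_self hC] at this
  exact this

/-! ## The two one-Poisson-binomial inequalities on a position set -/

/-- **Surplus on a position set**: for `C ⊆ range K` with `E(C) ≥ 4` and `η ≤ h k` (`k < K`):  `(1 − V(C))·(E(C) − 3) ≤ 1 − η`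
(`Quant.CountDP.surplus_far_two` through the bridge). [this work] -/
theorem one_sub_hairV_mul_le {h : ℕ → ℝ} (hh : ∀ k, 0 ≤ h k ∧ h k ≤ 1) {η : ℝ} (hη : ∀ k, k < K → η ≤ h k)
    {C : Finset ℕ} (hC : C ⊆ range K) (hE : 4 ≤ ∑ k ∈ C, h k) :
    (1 - hairV K h 2 C) * (∑ k ∈ C, h k - 3) ≤ 1 - η := by
  have hb := hairV_eq_one_sub_cdf (K := K) h 2 C
  have hs := Quant.CountDP.surplus_far_two (fun i => h (Nat.nth (· ∈ C) i)) (nth_trials_mem hh C)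
    (m := Nat.count (· ∈ C) K) (eta_le_nth_trials hη C) (by rw [sum_nth_trials_eq hC h]; exact hE)
  rw [sum_nth_trials_eq hC h] at hs
  rw [hb]
  simpa using hs

/-- **`η ≤ F`** (fixed-set FAR at the full set): for `Σ ≥ 4`, `η ≤ hairV K h 2 (range K)`. [this work] -/
theorem eta_le_hairV_univ {h : ℕ → ℝ} (hh : ∀ k, 0 ≤ h k ∧ h k ≤ 1) {η : ℝ} (hη : ∀ k, k < K → η ≤ h k)
    (hS4tot : 4 ≤ ∑ k ∈ range K, h k) : η ≤ hairV K h 2 (range K) := by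
  have h1 := one_sub_hairV_mul_le hh hη (subset_refl _) hS4tot
  have hV1 : hairV K h 2 (range K) ≤ 1 := hairV_le_one' (fun k _ => hh k) 2 (range K)
  nlinarith

/-- **Deficit on a position set**: for `C ⊆ range K` with `E(C) ≤ 4`, `0 < η ≤ h k` (`k < K`):  `η(E(C) − 2)/2 ≤ V(C)`
(`Quant.CountDP.deficit_far_two` through the bridge). [this work] -/
theorem deficit_le_hairV {h : ℕ → ℝ} (hh : ∀ k, 0 ≤ h k ∧ h k ≤ 1) {η : ℝ} (hη0 : 0 < η) (hη : ∀ k, k < K → η ≤ h k)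
    {C : Finset ℕ} (hC : C ⊆ range K) (hE : ∑ k ∈ C, h k ≤ 4) :
    η * (∑ k ∈ C, h k - 2) / 2 ≤ hairV K h 2 C := by
  have hb := hairV_eq_one_sub_cdf (K := K) h 2 C
  have hd := Quant.CountDP.deficit_far_two (fun i => h (Nat.nth (· ∈ C) i)) (nth_trials_mem hh C) hη0
    (m := Nat.count (· ∈ C) K) (eta_le_nth_trials hη C) (by rw [sum_nth_trials_eq hC h]; exact hE)
  rw [sum_nth_trials_eq hC h] at hd
  rw [hb]
  simpa using hd

/-! ## LEMMA L -/

/-- **LEMMA L (the long rows of the weakest-hair bet never bind).**  For `h ∈ [0,1]`, any real `η` with `η ≤ h k` (`k < K`), and every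
`C ⊆ range K` with `E(C) > 4`:  `(F − η)·(E(C) − 4) ≤ (V(C) − η)·(Σ − 4)`, i.e. the row `η + μ_W(E(C) − 4) ≤ V(C)` of `W(μ_W)`. [this work] -/
theorem lemmaL {h : ℕ → ℝ} (hh : ∀ k, 0 ≤ h k ∧ h k ≤ 1) {η : ℝ} (hη : ∀ k, k < K → η ≤ h k)
    {C : Finset ℕ} (hC : C ⊆ range K) (hE : 4 < ∑ k ∈ C, h k) :
    (hairV K h 2 (range K) - η) * (∑ k ∈ C, h k - 4) ≤ (hairV K h 2 C - η) * (∑ k ∈ range K, h k - 4) := by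
  set V := hairV K h 2 C with hVdef
  set F := hairV K h 2 (range K) with hFdef
  set u := ∑ k ∈ C, h k - 4 with hudef
  set g := ∑ k ∈ range K \ C, h k with hgdef
  have hu0 : 0 < u := by rw [hudef]; linarith
  have hg0 : 0 ≤ g := Finset.sum_nonneg fun k _ => (hh k).1
  have hS4tot : ∑ k ∈ range K, h k - 4 = u + g := by
    rw [hudef, hgdef, ← Finset.sum_sdiff hC]; ring
  rw [hS4tot]
  -- gap bound and surplus
  have hδ : F - V ≤ (1 - V) * min 1 g := hairV_univ_sub_hairV_le (fun k _ => hh k) 2 C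
  have hs : (1 - V) * (∑ k ∈ C, h k - 3) ≤ 1 - η := one_sub_hairV_mul_le hh hη hC (by linarith)
  have hs' : (1 - V) * u ≤ V - η := by
    have e : (1 - V) * (∑ k ∈ C, h k - 3) = (1 - V) * u + (1 - V) := by rw [hudef]; ring
    linarith [e ▸ hs]
  have hV1 : V ≤ 1 := hairV_le_one' (fun k _ => hh k) 2 C
  have hVη : 0 ≤ V - η := le_trans (mul_nonneg (by linarith) hu0.le) hs'
  have hmin0 : 0 ≤ min 1 g := le_min zero_le_one hg0
  -- `(F−η)u = (V−η)u + (F−V)u ≤ (V−η)u + (1−V)u·min(1,g) ≤ (V−η)u + (V−η)min(1,g) ≤ (V−η)(u+g)`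
  have h1 : (F - V) * u ≤ (1 - V) * u * min 1 g := by nlinarith [mul_le_mul_of_nonneg_right hδ hu0.le]
  have h2 : (1 - V) * u * min 1 g ≤ (V - η) * min 1 g := mul_le_mul_of_nonneg_right hs' hmin0
  have h3 : (V - η) * min 1 g ≤ (V - η) * g := mul_le_mul_of_nonneg_left (min_le_right 1 g) hVη
  nlinarith

/-! ## THM B -/

/-- **THM B (the weakest-hair bet in its regime).**  Let `h ∈ [0,1]` with `Σ = Σ_{k<K} h k > 4`, let `m < K` carry a least weight
`η = h m` (`η ≤ h k` for `k < K`), `F = hairV K h 2 (range K)`, and suppose `η(Σ − 4) ≤ 2(F − η)`.  Then the weakest-hair bet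
`λ = δ_m`, `μ_W = (F − η)/(Σ − 4)` is a hair-only certificate at layer `2`: `λ ≥ 0`, `Σ_{k<K} λ_k = 1`, `μ_W ≥ 0`, and on every coverage
set `C = cov K l l'`, `(l,l') ∈ arcIx K`:  `Σ_{k∈C} λ_k h_k + μ_W (Σ_{k∈C} h_k − 2·2) ≤ hairV K h 2 C`
(the hypothesis shape of `HairyCycle.sunFAR_of_hairCert`). [this work] -/
theorem hairCert_of_weakestBet {h : ℕ → ℝ} (hh : ∀ k, 0 ≤ h k ∧ h k ≤ 1) (hS4tot : 4 < ∑ k ∈ range K, h k)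
    {m : ℕ} (hm : m < K) (hmin : ∀ k, k < K → h m ≤ h k)
    (hB : h m * (∑ k ∈ range K, h k - 4) ≤ 2 * (hairV K h 2 (range K) - h m)) :
    ∃ lam : ℕ → ℝ, ∃ μ : ℝ, (∀ k, 0 ≤ lam k) ∧ ∑ k ∈ range K, lam k = 1 ∧ 0 ≤ μ ∧
      ∀ p ∈ arcIx K, ∑ k ∈ cov K p.1 p.2, lam k * h k + μ * (∑ k ∈ cov K p.1 p.2, h k - 2 * (2 : ℕ)) ≤
        hairV K h 2 (cov K p.1 p.2) := by
  set η := h m with hηdef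
  set S := ∑ k ∈ range K, h k with hSdef
  set F := hairV K h 2 (range K) with hFdef
  have hη0 : 0 ≤ η := (hh m).1
  have hS4 : 0 < S - 4 := by linarith
  have hFη : η ≤ F := eta_le_hairV_univ hh hmin (by linarith)
  set μ := (F - η) / (S - 4) with hμdef
  have hμ0 : 0 ≤ μ := div_nonneg (by linarith) hS4.le
  have hμη : η / 2 ≤ μ := by
    rw [hμdef, le_div_iff₀ hS4]; linarith
  refine ⟨fun k => if k = m then 1 else 0, μ, fun k => by dsimp only; split_ifs <;> norm_num, ?_, hμ0, ?_⟩
  · rw [Finset.sum_ite_eq' (range K) m (fun _ => (1 : ℝ)), if_pos (Finset.mem_range.2 hm)]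
  · intro p _
    set C := cov K p.1 p.2 with hCdef
    have hC : C ⊆ range K := fun _ hk => Finset.mem_range.2 (mem_cov.1 hk).1
    set EC := ∑ k ∈ C, h k with hECdef
    set V := hairV K h 2 C with hVdef
    have hV0 : 0 ≤ V := hairV_nonneg' (fun k _ => hh k) 2 C
    -- the bet's row sum on `C`
    have hrow : ∑ k ∈ C, (if k = m then (1 : ℝ) else 0) * h k = if m ∈ C then η else 0 := by
      have e : ∀ k ∈ C, (if k = m then (1 : ℝ) else 0) * h k = if k = m then η else 0 := by
        intro k _
        split_ifs with hk
        · rw [hk, hηdef]; ring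
        · ring
      rw [Finset.sum_congr rfl e, Finset.sum_ite_eq' C m (fun _ => η)]
    rw [hrow]
    push_cast
    have hind : (if m ∈ C then η else 0) ≤ η := by split_ifs <;> linarith
    have hind0 : 0 ≤ (if m ∈ C then η else 0) := by split_ifs <;> linarith
    rcases lt_or_ge 4 EC with hlong | hshort
    · ----------------------------------------------------------------
      -- long row: LEMMA L gives `μ (E(C) − 4) ≤ V − η`
      ----------------------------------------------------------------
      have hL := lemmaL hh hmin hC hlong
      rw [← hECdef, ← hSdef, ← hFdef, ← hVdef] at hL
      have hμE : μ * (EC - 4) ≤ V - η := by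
        rw [hμdef, div_mul_eq_mul_div, div_le_iff₀ hS4]
        linarith
      have : μ * (EC - 2 * 2) = μ * (EC - 4) := by ring
      linarith
    · ----------------------------------------------------------------
      -- short row: trivial off `m`; through `m` by the deficit inequality and `μ ≥ η/2`
      ----------------------------------------------------------------
      have hμE : μ * (EC - 2 * 2) ≤ 0 := by nlinarith
      by_cases hmC : m ∈ C
      · rw [if_pos hmC]
        rcases eq_or_lt_of_le hη0 with hz | hpos
        · -- `η = 0`
          rw [← hz]; linarith
        · have hd := deficit_le_hairV hh hpos hmin hC hshort
          rw [← hECdef, ← hVdef] at hd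
          -- `η + μ(EC − 4) ≤ η − (η/2)(4 − EC) = η(EC − 2)/2 ≤ V`
          have h4 : 0 ≤ 4 - EC := by linarith
          nlinarith [mul_le_mul_of_nonneg_right hμη h4]
      · rw [if_neg hmC]; linarith

end Summit.CriticalPhenomena.PercolationContinuityZ3.Theorems.HairyCycle

end
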